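import Mathlib.RepresentationTheory.Basic
import Mathlib.LinearAlgebra.Dimension.Finrank
import Mathlib.Algebra.BigOperators.Group.Finset.Basic
import HarnessLib

/-!
# Wedderburn certificates VIII: transport of a certificate along a group isomorphism

COR-CM (cell `pub-hodgecm2`, binder seat `b16` gen 58, count-neutral claim CERTIFICATES, file F9 — abstract finite-group
level; theorems only, no definition, no named fact, no `sorry`).  NEW as stated, hence under `Summits/`.  HONEST FRAMING:
bookkeeping only; `HC_CM` is neither used nor asserted.

A census seat builds a Wedderburn certificate ONCE for a concrete finite group `G'` (e.g. `QuaternionGroup 2` on `ℍ_ℚ`,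
`CorCM/IrreducibleOddWeightsCertificateQuaternion`; `DihedralGroup 4` on `ℚ²`; …) and meets the Galois group
`G = Gal(L/ℚ)` of a CM field only through an isomorphism `φ : G ≃* G'` carrying complex conjugation `ρ` to the central
involution `φ ρ` of the model.  This file moves the four certificate hypotheses of F1–F7 (`Z_k`-linearity, `π_k(ρ) = −1`,
the COUNT, FAITHFULNESS of `ℚ^G` resp. of the odd functions `ℚ[G]⁻`) from `(G', π'_k)` to `(G, π'_k ∘ φ)`, so that the
CM-field theorems (`cmFamilyRank_eq_one_add_sum_of_oddCertificate`, the Helly number, Mai's criterion, …) apply to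
`π_k := π'_k ∘ φ` verbatim:

* `comp_apply_smul`, `comp_apply_rho` — linearity and oddness are pointwise;
* **`faithful_comp_of_faithful`**, **`oddFaithful_comp_of_oddFaithful`** — faithfulness pulls back (reindex the sum by `φ`);
* `card_eq_of_mulEquiv` — the count is unchanged (`|G| = |G'|`);
* **`oddCertificate_comp`** — the four odd-certificate hypotheses for `(G, π' ∘ φ, ρ)` from those for `(G', π', φ ρ)`,
  packaged as one conjunction.

## References

* [Serre1977] J.-P. Serre, *Linear Representations of Finite Groups*, GTM 42 (1977), §6.5 Prop. 16 and §12.2.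
-/

set_option autoImplicit false

noncomputable section

open scoped BigOperators

universe u' v w w'

namespace Summit.HodgeConjecture.CorCM.IrrOdd

variable {G : Type w} [Group G] [Fintype G] {G' : Type w'} [Group G'] [Fintype G']
variable {K : Type u'} [Fintype K]
variable {V : K → Type v} [∀ k, AddCommGroup (V k)] [∀ k, Module ℚ (V k)]
variable {Z : K → Type*} [∀ k, DivisionRing (Z k)] [∀ k, Module (Z k) (V k)]

omit [Fintype G] [Fintype G'] [Fintype K] in
/-- `Z_k`-linearity is preserved by composing with a homomorphism. [folklore] -/
theorem comp_apply_smul (φ : G →* G') (π' : ∀ k, Representation ℚ G' (V k))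
    (hlin' : ∀ k (g' : G') (z : Z k) (v : V k), π' k g' (z • v) = z • π' k g' v) (k : K) (g : G) (z : Z k)
    (v : V k) : (π' k).comp φ g (z • v) = z • (π' k).comp φ g v :=
  hlin' k (φ g) z v

omit [Fintype G] [Fintype G'] [Fintype K] [∀ k, DivisionRing (Z k)] [∀ k, Module (Z k) (V k)] in
/-- `(π' ∘ φ)(ρ) = π'(φ ρ) = −1`. [folklore] -/
theorem comp_apply_rho (φ : G →* G') (π' : ∀ k, Representation ℚ G' (V k)) {ρ : G}
    (hodd' : ∀ k (v : V k), π' k (φ ρ) v = -v) (k : K) (v : V k) : (π' k).comp φ ρ v = -v :=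
  hodd' k v

omit [Fintype K] [∀ k, DivisionRing (Z k)] [∀ k, Module (Z k) (V k)] in
/-- The count is invariant: `|G| = |G'|` along an isomorphism. [folklore] -/
theorem card_eq_of_mulEquiv (φ : G ≃* G') : Fintype.card G = Fintype.card G' :=
  Fintype.card_congr φ.toEquiv

omit [Fintype K] [∀ k, DivisionRing (Z k)] [∀ k, Module (Z k) (V k)] in
/-- Reindexing the certificate sums along `φ`: `Σ_{g'} c(φ⁻¹ g') π'(g') = Σ_g c(g) π'(φ g)`. [folklore] -/
theorem sum_comp_symm_smul_eq (φ : G ≃* G') (π' : ∀ k, Representation ℚ G' (V k)) (c : G → ℚ) (k : K) :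
    ∑ g', c (φ.symm g') • π' k g' = ∑ g, c g • (π' k).comp φ.toMonoidHom g := by
  rw [← Equiv.sum_comp φ.toEquiv]
  refine Finset.sum_congr rfl fun g _ => ?_
  change c (φ.symm (φ g)) • π' k (φ g) = c g • π' k (φ g)
  rw [MulEquiv.symm_apply_apply]

omit [Fintype K] [∀ k, DivisionRing (Z k)] [∀ k, Module (Z k) (V k)] in
/-- **FULL FAITHFULNESS pulls back along an isomorphism**: if `ℚ^{G'}` is faithful on `⊕_k V_k` through `π'`, then `ℚ^G` is
faithful through `π' ∘ φ`. [cite: Serre1977, §6.5 Prop. 16 and §12.2] -/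
theorem faithful_comp_of_faithful (φ : G ≃* G') (π' : ∀ k, Representation ℚ G' (V k))
    (hfaith' : ∀ c' : G' → ℚ, (∀ k, ∑ g', c' g' • π' k g' = 0) → c' = 0) (c : G → ℚ)
    (h0 : ∀ k, ∑ g, c g • (π' k).comp φ.toMonoidHom g = 0) : c = 0 := by
  have hc' : (fun g' => c (φ.symm g')) = 0 := hfaith' _ fun k => by rw [sum_comp_symm_smul_eq, h0]
  funext g
  have := congrFun hc' (φ g)
  simpa using this

omit [Fintype K] [∀ k, DivisionRing (Z k)] [∀ k, Module (Z k) (V k)] in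
/-- **ODD FAITHFULNESS pulls back along an isomorphism** carrying `ρ` to `φ ρ`: if the `φρ`-odd functions on `G'` are
faithful through `π'`, the `ρ`-odd functions on `G` are faithful through `π' ∘ φ`. [cite: Serre1977, §6.5 Prop. 16 and §12.2] -/
theorem oddFaithful_comp_of_oddFaithful (φ : G ≃* G') (π' : ∀ k, Representation ℚ G' (V k)) {ρ : G}
    (hfaith' : ∀ c' : G' → ℚ, (∀ g', c' (φ ρ * g') = -c' g') → (∀ k, ∑ g', c' g' • π' k g' = 0) → c' = 0)
    (c : G → ℚ) (hc : ∀ g, c (ρ * g) = -c g) (h0 : ∀ k, ∑ g, c g • (π' k).comp φ.toMonoidHom g = 0) : c = 0 := by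
  have hc' : (fun g' => c (φ.symm g')) = 0 := hfaith' _ (fun g' => by
      show c (φ.symm (φ ρ * g')) = -c (φ.symm g')
      rw [map_mul, MulEquiv.symm_apply_apply, hc]) fun k => by rw [sum_comp_symm_smul_eq, h0]
  funext g
  have := congrFun hc' (φ g)
  simpa using this

omit [Fintype K] in
/-- **TRANSPORT OF AN ODD CERTIFICATE along `φ : G ≃* G'` with `ρ ↦ φ ρ`.**  From `Z_k`-linearity, `π'_k(φρ) = −1`, the
count `2 Σ_k r_k d_k ≤ |G'|` and `φρ`-odd faithfulness for `(G', π')` one gets the same four hypotheses for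
`(G, π' ∘ φ, ρ)` — in exactly the shape consumed by the CM-field files (`…CertificateCMFields`, `…CertificateCMTypes`) with
`G = Gal(L/ℚ)`. [cite: Serre1977, §6.5 Prop. 16 and §12.2] -/
theorem oddCertificate_comp [Fintype K] (φ : G ≃* G') (π' : ∀ k, Representation ℚ G' (V k)) {ρ : G}
    (hlin' : ∀ k (g' : G') (z : Z k) (v : V k), π' k g' (z • v) = z • π' k g' v)
    (hodd' : ∀ k (v : V k), π' k (φ ρ) v = -v)
    (hcount' : 2 * ∑ k, Module.finrank (Z k) (V k) * Module.finrank ℚ (V k) ≤ Fintype.card G')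
    (hfaith' : ∀ c' : G' → ℚ, (∀ g', c' (φ ρ * g') = -c' g') → (∀ k, ∑ g', c' g' • π' k g' = 0) → c' = 0) :
    (∀ k (g : G) (z : Z k) (v : V k), (π' k).comp φ.toMonoidHom g (z • v) = z • (π' k).comp φ.toMonoidHom g v) ∧
      (∀ k (v : V k), (π' k).comp φ.toMonoidHom ρ v = -v) ∧
      2 * ∑ k, Module.finrank (Z k) (V k) * Module.finrank ℚ (V k) ≤ Fintype.card G ∧
      (∀ c : G → ℚ, (∀ g, c (ρ * g) = -c g) → (∀ k, ∑ g, c g • (π' k).comp φ.toMonoidHom g = 0) → c = 0) :=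
  ⟨fun k g z v => hlin' k (φ g) z v, fun k v => hodd' k v, by rwa [card_eq_of_mulEquiv φ],
    fun c hc h0 => oddFaithful_comp_of_oddFaithful φ π' hfaith' c hc h0⟩

omit [Fintype K] in
/-- **TRANSPORT OF A FULL CERTIFICATE along `φ : G ≃* G'`**: `Z_k`-linearity, `Σ_k r_k d_k ≤ |G|` and full faithfulness
for `(G, π' ∘ φ)` from those for `(G', π')`. [cite: Serre1977, §6.5 Prop. 16 and §12.2] -/
theorem certificate_comp [Fintype K] (φ : G ≃* G') (π' : ∀ k, Representation ℚ G' (V k))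
    (hlin' : ∀ k (g' : G') (z : Z k) (v : V k), π' k g' (z • v) = z • π' k g' v)
    (hcount' : ∑ k, Module.finrank (Z k) (V k) * Module.finrank ℚ (V k) ≤ Fintype.card G')
    (hfaith' : ∀ c' : G' → ℚ, (∀ k, ∑ g', c' g' • π' k g' = 0) → c' = 0) :
    (∀ k (g : G) (z : Z k) (v : V k), (π' k).comp φ.toMonoidHom g (z • v) = z • (π' k).comp φ.toMonoidHom g v) ∧
      ∑ k, Module.finrank (Z k) (V k) * Module.finrank ℚ (V k) ≤ Fintype.card G ∧
      (∀ c : G → ℚ, (∀ k, ∑ g, c g • (π' k).comp φ.toMonoidHom g = 0) → c = 0) :=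
  ⟨fun k g z v => hlin' k (φ g) z v, by rwa [card_eq_of_mulEquiv φ], fun c h0 => faithful_comp_of_faithful φ π' hfaith' c h0⟩

end Summit.HodgeConjecture.CorCM.IrrOdd

end
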